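import Literature.Analysis.Complex.LoewnerFastTrackConcave
import HarnessLib

/-!
# Loewner's theorem, Part I — step 4: Jensen's operator inequality and the one-sided
# Bendat–Sherman theorem (Hansen–Pedersen 1982, Theorems 2.1 and 2.4)

Fourth brick of the hard direction (`→`) of `Literature.Analysis.Complex.loewner_theorem` along
Hansen's fast track [Hansen2013], whose Lemma 4.1 invokes the Bendat–Sherman theorem at the left
end point of the domain; for that one-sided case Hansen–Pedersen's algebraic proof
(F. Hansen, G. K. Pedersen, *Jensen's inequality for operators and Löwner's theorem*, Math. Ann.
258 (1982) 229–241, Theorem 2.1 (i) ⇒ (ii) and Theorem 2.4 (ii) ⇒ (v)) suffices and avoids all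
differential calculus:

* `mul_cfc_one_sub_star_mul_self` — the intertwining `a F(1 - a⋆a) = F(1 - aa⋆) a` (polynomial
  transport of the functional calculus);
* `conj_cfc_sub_cfc_conj_posSemidef` — **Jensen's operator inequality**: if `f` is midpoint
  operator convex on Hermitian matrices (of order `2n`) with spectra in `I ∋ 0` and `f(0) ≤ 0`, then
  `f(a⋆xa) ≤ a⋆f(x)a` for contractions `a` and Hermitian `x` of order `n` with spectrum in `I`
  (unitary dilations `U = [[a, b], [c, -a⋆]]`, `V = [[a, -b], [c, a⋆]]`, `b = √(1 - aa⋆)`,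
  `c = √(1 - a⋆a)`, and `½U⋆(x ⊕ 0)U + ½V⋆(x ⊕ 0)V = a⋆xa ⊕ bxb`);
* `cfc_inv_mul_monotone_of_jensen` — **one-sided Bendat–Sherman**: Jensen's operator inequality
  implies that `t ↦ t⁻¹f(t)` is `n`-monotone on positive definite matrices (`a = (√y)⁻¹√x`).

Square roots are taken through `cfc Real.sqrt` (`cfc_sqrt_mul_self`, `cfc_sqrt_data`). No new
definitions.
-/

noncomputable section

open scoped ComplexOrder ComplexConjugate MatrixOrder Matrix.Norms.L2Operator
open Complex Set Filter Topology Metric Real Matrix Polynomial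

namespace Literature.Analysis.Complex

/-! ## Jensen's operator inequality (Hansen–Pedersen 1982, Theorem 2.1 (i) ⇒ (ii)) -/

section JensenOperator

variable {m : Type*} [Fintype m] [DecidableEq m]

/-- Intertwining of polynomial calculi: `a · q(a⋆a) = q(aa⋆) · a`. [folklore] -/
theorem mul_aeval_conjTranspose_mul_self (a : Matrix m m ℂ) (q : ℝ[X]) :
    a * aeval (star a * a) q = aeval (a * star a) q * a := by
  induction q using Polynomial.induction_on' with
  | add p q hp hq => rw [map_add, map_add, Matrix.mul_add, Matrix.add_mul, hp, hq]
  | monomial k c =>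
    rw [aeval_monomial, aeval_monomial, Algebra.algebraMap_eq_smul_one, smul_mul_assoc, one_mul,
      smul_mul_assoc, one_mul, Matrix.mul_smul, Matrix.smul_mul]
    congr 1
    induction k with
    | zero => simp
    | succ k ih =>
      rw [pow_succ, ← Matrix.mul_assoc, ih, pow_succ]
      simp only [Matrix.mul_assoc]

/-- `1 - a⋆a` and `1 - aa⋆` are Hermitian. [folklore] -/
theorem isHermitian_one_sub_star_mul_self (a : Matrix m m ℂ) :
    (1 - star a * a : Matrix m m ℂ).IsHermitian ∧ (1 - a * star a : Matrix m m ℂ).IsHermitian := by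
  constructor
  · unfold Matrix.IsHermitian
    rw [conjTranspose_sub, conjTranspose_one, star_eq_conjTranspose, conjTranspose_mul,
      conjTranspose_conjTranspose]
  · unfold Matrix.IsHermitian
    rw [conjTranspose_sub, conjTranspose_one, star_eq_conjTranspose, conjTranspose_mul,
      conjTranspose_conjTranspose]

/-- **Intertwining of the defect operators**: `a · F(a⋆a) = F(aa⋆) · a` for every real function
`F` (here applied to `1 - a⋆a`, `1 - aa⋆`): `a √(1 - a⋆a) = √(1 - aa⋆) a`. [folklore] -/
theorem mul_cfc_one_sub_star_mul_self (a : Matrix m m ℂ) (F : ℝ → ℝ) :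
    a * cfc F (1 - star a * a) = cfc F (1 - a * star a) * a := by
  obtain ⟨h1, h2⟩ := isHermitian_one_sub_star_mul_self a
  obtain ⟨p, hp⟩ := exists_polynomial_eqOn_finite
    ((Matrix.finite_real_spectrum (A := (1 - star a * a : Matrix m m ℂ))).union
      (Matrix.finite_real_spectrum (A := (1 - a * star a : Matrix m m ℂ)))) F
  rw [cfc_eq_aeval_of_eqOn h1 fun x hx => hp x (Or.inl hx),
    cfc_eq_aeval_of_eqOn h2 fun x hx => hp x (Or.inr hx)]
  -- `aeval (1 - a⋆a) p = aeval (a⋆a) (p ∘ (1 - X))`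
  have e1 : aeval (1 - star a * a : Matrix m m ℂ) p = aeval (star a * a) (p.comp (1 - Polynomial.X)) := by
    rw [Polynomial.aeval_comp]; congr 1; simp
  have e2 : aeval (1 - a * star a : Matrix m m ℂ) p = aeval (a * star a) (p.comp (1 - Polynomial.X)) := by
    rw [Polynomial.aeval_comp]; congr 1; simp
  rw [e1, e2, mul_aeval_conjTranspose_mul_self]

end JensenOperator

section JensenOperator2

variable {n : ℕ}

/-- The square root of a positive semidefinite matrix through the functional calculus:
`√P · √P = P`. [folklore] -/
theorem cfc_sqrt_mul_self {k : Type*} [Fintype k] [DecidableEq k] {P : Matrix k k ℂ}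
    (hP : P.PosSemidef) : cfc Real.sqrt P * cfc Real.sqrt P = P := by
  have hP' : IsSelfAdjoint P := hP.1
  have hfin := Matrix.finite_real_spectrum (A := P)
  rw [← cfc_mul Real.sqrt Real.sqrt P (hfin.continuousOn _) (hfin.continuousOn _)]
  have : (spectrum ℝ P).EqOn (fun x => Real.sqrt x * Real.sqrt x) id := by
    intro x hx
    rw [hP.1.spectrum_real_eq_range_eigenvalues] at hx
    obtain ⟨i, rfl⟩ := hx
    exact Real.mul_self_sqrt (hP.eigenvalues_nonneg i)
  rw [cfc_congr this, cfc_id ℝ P hP']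

/-- **Jensen's operator inequality** (Hansen–Pedersen 1982, Theorem 2.1, (i) ⇒ (ii); Hansen 2013
uses it through Theorem 2.4): if `f` is (midpoint) operator convex on Hermitian matrices with
spectra in a set `I ∋ 0` and `f(0) ≤ 0`, then `f(a⋆xa) ≤ a⋆f(x)a` for every contraction `a` and
Hermitian `x` with spectrum in `I`. Proof: the unitary dilations `U = [[a, b], [c, -a⋆]]`,
`V = [[a, -b], [c, a⋆]]` (`b = √(1 - aa⋆)`, `c = √(1 - a⋆a)`) satisfy
`½U⋆(x ⊕ 0)U + ½V⋆(x ⊕ 0)V = a⋆xa ⊕ bxb`. [cite: Hansen2013, Section 1.1] -/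
theorem conj_cfc_sub_cfc_conj_posSemidef {f : ℝ → ℝ} {I : Set ℝ} (h0 : (0 : ℝ) ∈ I)
    (hf0 : f 0 ≤ 0)
    (hconv : ∀ X Y : Matrix (Fin n ⊕ Fin n) (Fin n ⊕ Fin n) ℂ, X.IsHermitian → Y.IsHermitian →
      spectrum ℝ X ⊆ I → spectrum ℝ Y ⊆ I →
        ((2 : ℂ)⁻¹ • cfc f X + (2 : ℂ)⁻¹ • cfc f Y -
          cfc f ((2 : ℂ)⁻¹ • X + (2 : ℂ)⁻¹ • Y)).PosSemidef)
    {a x : Matrix (Fin n) (Fin n) ℂ} (ha : (1 - aᴴ * a).PosSemidef)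
    (ha' : (1 - a * aᴴ).PosSemidef) (hx : x.IsHermitian) (hxs : spectrum ℝ x ⊆ I) :
    (aᴴ * cfc f x * a - cfc f (aᴴ * x * a)).PosSemidef := by
  -- the defect operators
  set c : Matrix (Fin n) (Fin n) ℂ := cfc Real.sqrt (1 - aᴴ * a) with hc
  set b : Matrix (Fin n) (Fin n) ℂ := cfc Real.sqrt (1 - a * aᴴ) with hb
  have hch : c.IsHermitian := (cfc_predicate Real.sqrt (1 - aᴴ * a) : IsSelfAdjoint _)
  have hbh : b.IsHermitian := (cfc_predicate Real.sqrt (1 - a * aᴴ) : IsSelfAdjoint _)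
  have hcc : c * c = 1 - aᴴ * a := cfc_sqrt_mul_self ha
  have hbb : b * b = 1 - a * aᴴ := cfc_sqrt_mul_self ha'
  have hac : a * c = b * a := mul_cfc_one_sub_star_mul_self a Real.sqrt
  have hca : c * aᴴ = aᴴ * b := by
    have h := congrArg star hac
    rw [star_mul, star_mul, star_eq_conjTranspose c, hch.eq, star_eq_conjTranspose b, hbh.eq] at h
    exact h
  have haa : a * aᴴ + b * b = 1 := by rw [hbb]; abel
  have hcc' : c * c + aᴴ * a = 1 := by rw [hcc]; abel
  -- the unitary dilations
  set U : Matrix (Fin n ⊕ Fin n) (Fin n ⊕ Fin n) ℂ := fromBlocks a b c (-aᴴ) with hU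
  set V : Matrix (Fin n ⊕ Fin n) (Fin n ⊕ Fin n) ℂ := fromBlocks a (-b) c aᴴ with hV
  have hsU : star U = fromBlocks aᴴ c b (-a) := by
    rw [hU, star_eq_conjTranspose, fromBlocks_conjTranspose, hch.eq, hbh.eq, conjTranspose_neg,
      conjTranspose_conjTranspose]
  have hsV : star V = fromBlocks aᴴ c (-b) a := by
    rw [hV, star_eq_conjTranspose, fromBlocks_conjTranspose, hch.eq, conjTranspose_neg, hbh.eq,
      conjTranspose_conjTranspose]
  have hUu : U ∈ Matrix.unitaryGroup (Fin n ⊕ Fin n) ℂ := by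
    rw [Matrix.mem_unitaryGroup_iff, hsU, hU, fromBlocks_multiply, ← fromBlocks_one]
    refine Matrix.fromBlocks_inj.mpr ⟨haa, ?_, ?_, ?_⟩
    · rw [hac, Matrix.mul_neg]; abel
    · rw [hca, Matrix.neg_mul]; abel
    · rw [Matrix.neg_mul, Matrix.mul_neg, neg_neg, hcc']
  have hVu : V ∈ Matrix.unitaryGroup (Fin n ⊕ Fin n) ℂ := by
    rw [Matrix.mem_unitaryGroup_iff, hsV, hV, fromBlocks_multiply, ← fromBlocks_one]
    refine Matrix.fromBlocks_inj.mpr ⟨?_, ?_, ?_, hcc'⟩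
    · rw [Matrix.neg_mul, Matrix.mul_neg, neg_neg, haa]
    · rw [Matrix.neg_mul, hac]; abel
    · rw [Matrix.mul_neg, hca]; abel
  -- the matrix `X = x ⊕ 0` and its conjugates
  set X : Matrix (Fin n ⊕ Fin n) (Fin n ⊕ Fin n) ℂ := fromBlocks x 0 0 0 with hX
  have h0h : (0 : Matrix (Fin n) (Fin n) ℂ).IsHermitian := by unfold Matrix.IsHermitian; simp
  have hXh : X.IsHermitian := IsHermitian.fromBlocks hx (by simp) h0h
  have hXs : spectrum ℝ X ⊆ I := by
    refine (spectrum_fromBlocks_diag_subset x 0).trans (union_subset hxs ?_)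
    have := spectrum_smul_one_subset (k := Fin n) 0
    rw [ofReal_zero, zero_smul] at this
    exact this.trans (by simpa using h0)
  have hsUu : star U ∈ Matrix.unitaryGroup (Fin n ⊕ Fin n) ℂ := Unitary.star_mem hUu
  have hsVu : star V ∈ Matrix.unitaryGroup (Fin n ⊕ Fin n) ℂ := Unitary.star_mem hVu
  have hconjh : ∀ {W : Matrix (Fin n ⊕ Fin n) (Fin n ⊕ Fin n) ℂ},
      W ∈ Matrix.unitaryGroup (Fin n ⊕ Fin n) ℂ → (star W * X * W).IsHermitian := by
    intro W hW
    unfold Matrix.IsHermitian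
    rw [star_eq_conjTranspose, conjTranspose_mul, conjTranspose_mul, conjTranspose_conjTranspose,
      hXh.eq, Matrix.mul_assoc]
  have hconjs : ∀ {W : Matrix (Fin n ⊕ Fin n) (Fin n ⊕ Fin n) ℂ},
      W ∈ Matrix.unitaryGroup (Fin n ⊕ Fin n) ℂ → spectrum ℝ (star W * X * W) ⊆ I := by
    intro W hW
    have hφ : star W * X * W = Unitary.conjStarAlgAut ℝ _ ⟨star W, Unitary.star_mem hW⟩ X := by
      rw [Unitary.conjStarAlgAut_apply]; simp
    rw [hφ, AlgEquiv.spectrum_eq]; exact hXs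
  have hmono := hconv (star U * X * U) (star V * X * V) (hconjh hUu) (hconjh hVu) (hconjs hUu)
    (hconjs hVu)
  -- block computations
  have havg : (2 : ℂ)⁻¹ • (star U * X * U) + (2 : ℂ)⁻¹ • (star V * X * V) =
      fromBlocks (aᴴ * x * a) 0 0 (b * x * b) := by
    rw [hsU, hsV, hX, hU, hV]
    simp only [fromBlocks_multiply, Matrix.mul_zero, Matrix.zero_mul, add_zero,
      Matrix.mul_neg, Matrix.neg_mul, neg_zero, fromBlocks_smul, fromBlocks_add, smul_neg]
    refine Matrix.fromBlocks_inj.mpr ⟨?_, ?_, ?_, ?_⟩ <;> module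
  have hfX : cfc f X = fromBlocks (cfc f x) 0 0 (((f 0 : ℝ) : ℂ) • 1) := by
    rw [hX, cfc_fromBlocks_diag hx h0h]
    congr 1
    have := cfc_smul_one (m := Fin n) 0 f
    rwa [ofReal_zero, zero_smul] at this
  have hfXU : cfc f (star U * X * U) = star U * cfc f X * U := by
    rw [show star U * X * U = star U * X * star (star U) by rw [star_star],
      cfc_unitary_conj hXh hsUu, star_star]
  have hfXV : cfc f (star V * X * V) = star V * cfc f X * V := by
    rw [show star V * X * V = star V * X * star (star V) by rw [star_star],
      cfc_unitary_conj hXh hsVu, star_star]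
  have havgf : (2 : ℂ)⁻¹ • cfc f (star U * X * U) + (2 : ℂ)⁻¹ • cfc f (star V * X * V) =
      fromBlocks (aᴴ * cfc f x * a + ((f 0 : ℝ) : ℂ) • (c * c)) 0 0
        (b * cfc f x * b + ((f 0 : ℝ) : ℂ) • (a * aᴴ)) := by
    rw [hfXU, hfXV, hfX, hsU, hsV, hU, hV]
    simp only [fromBlocks_multiply, Matrix.mul_zero, add_zero, zero_add,
      Matrix.mul_neg, Matrix.neg_mul, fromBlocks_smul, fromBlocks_add, Matrix.mul_smul,
      Matrix.smul_mul, Matrix.mul_one, smul_neg, neg_neg]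
    refine Matrix.fromBlocks_inj.mpr ⟨?_, ?_, ?_, ?_⟩ <;> module
  have haxa : (aᴴ * x * a).IsHermitian := by
    unfold Matrix.IsHermitian
    rw [conjTranspose_mul, conjTranspose_mul, hx.eq, conjTranspose_conjTranspose, Matrix.mul_assoc]
  have hbxb : (b * x * b).IsHermitian := by
    unfold Matrix.IsHermitian
    rw [conjTranspose_mul, conjTranspose_mul, hx.eq, hbh.eq, Matrix.mul_assoc]
  rw [havg, havgf, cfc_fromBlocks_diag haxa hbxb, fromBlocks_sub'] at hmono
  have hblock := hmono.submatrix Sum.inl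
  have hsub : (fromBlocks (aᴴ * cfc f x * a + ((f 0 : ℝ) : ℂ) • (c * c) - cfc f (aᴴ * x * a))
      (0 - 0) (0 - 0) (b * cfc f x * b + ((f 0 : ℝ) : ℂ) • (a * aᴴ) - cfc f (b * x * b))).submatrix
        Sum.inl Sum.inl = aᴴ * cfc f x * a + ((f 0 : ℝ) : ℂ) • (c * c) - cfc f (aᴴ * x * a) := by
    ext i j; simp
  rw [hsub] at hblock
  -- remove the (nonpositive) defect term `f(0) (1 - a⋆a)`
  have hdef : ((-(f 0) : ℝ) • (c * c)).PosSemidef := by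
    rw [hcc]; exact ha.smul (by linarith)
  have e : ((-(f 0) : ℝ) • (c * c) : Matrix (Fin n) (Fin n) ℂ) = -(((f 0 : ℝ) : ℂ) • (c * c)) := by
    rw [show ((-(f 0) : ℝ) • (c * c) : Matrix (Fin n) (Fin n) ℂ) = ((-(f 0) : ℝ) : ℂ) • (c * c) from rfl,
      ofReal_neg, neg_smul]
  have hsum : aᴴ * cfc f x * a - cfc f (aᴴ * x * a) =
      (aᴴ * cfc f x * a + ((f 0 : ℝ) : ℂ) • (c * c) - cfc f (aᴴ * x * a)) + (-(f 0) : ℝ) • (c * c) := by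
    rw [e]; abel
  rw [hsum]
  exact hblock.add hdef

end JensenOperator2

section BendatShermanOneSided

variable {n : ℕ}

/-- Functional calculus square-root data of a positive definite matrix: with `s = √x` and
`r = (√x)⁻¹` (both through `cfc`), `s s = x`, `r s = s r = 1`, `r r = x⁻¹`, all Hermitian.
[folklore] -/
theorem cfc_sqrt_data {x : Matrix (Fin n) (Fin n) ℂ} (hx : x.PosDef) :
    (cfc Real.sqrt x).IsHermitian ∧ (cfc (fun t => (Real.sqrt t)⁻¹) x).IsHermitian ∧
      cfc Real.sqrt x * cfc Real.sqrt x = x ∧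
      cfc (fun t => (Real.sqrt t)⁻¹) x * cfc Real.sqrt x = 1 ∧
      cfc Real.sqrt x * cfc (fun t => (Real.sqrt t)⁻¹) x = 1 ∧
      cfc (fun t => (Real.sqrt t)⁻¹) x * cfc (fun t => (Real.sqrt t)⁻¹) x = x⁻¹ := by
  have hx' : IsSelfAdjoint x := hx.1
  have hfin := Matrix.finite_real_spectrum (A := x)
  have hpos : ∀ t ∈ spectrum ℝ x, 0 < t := fun t ht => spectrum_subset_Ioi_of_posDef hx ht
  have h1 : (cfc Real.sqrt x).IsHermitian := (cfc_predicate Real.sqrt x : IsSelfAdjoint _)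
  have h2 : (cfc (fun t => (Real.sqrt t)⁻¹) x).IsHermitian :=
    (cfc_predicate (fun t => (Real.sqrt t)⁻¹) x : IsSelfAdjoint _)
  have hrs : cfc (fun t => (Real.sqrt t)⁻¹) x * cfc Real.sqrt x = 1 := by
    rw [← cfc_mul (fun t => (Real.sqrt t)⁻¹) Real.sqrt x (hfin.continuousOn _) (hfin.continuousOn _)]
    have : (spectrum ℝ x).EqOn (fun t => (Real.sqrt t)⁻¹ * Real.sqrt t) (fun _ => 1) := fun t ht =>
      inv_mul_cancel₀ (Real.sqrt_pos.2 (hpos t ht)).ne'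
    rw [cfc_congr this, cfc_const_one ℝ x]
  have hsr : cfc Real.sqrt x * cfc (fun t => (Real.sqrt t)⁻¹) x = 1 := by
    rw [← cfc_mul Real.sqrt (fun t => (Real.sqrt t)⁻¹) x (hfin.continuousOn _) (hfin.continuousOn _)]
    have : (spectrum ℝ x).EqOn (fun t => Real.sqrt t * (Real.sqrt t)⁻¹) (fun _ => 1) := fun t ht =>
      mul_inv_cancel₀ (Real.sqrt_pos.2 (hpos t ht)).ne'
    rw [cfc_congr this, cfc_const_one ℝ x]
  have hrr : cfc (fun t => (Real.sqrt t)⁻¹) x * cfc (fun t => (Real.sqrt t)⁻¹) x = x⁻¹ := by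
    rw [← cfc_mul (fun t => (Real.sqrt t)⁻¹) (fun t => (Real.sqrt t)⁻¹) x (hfin.continuousOn _)
      (hfin.continuousOn _)]
    have e : (spectrum ℝ x).EqOn (fun t => (Real.sqrt t)⁻¹ * (Real.sqrt t)⁻¹) (fun t => t⁻¹) := by
      intro t ht
      simp only
      rw [← mul_inv, Real.mul_self_sqrt (hpos t ht).le]
    rw [cfc_congr e]
    symm
    apply Matrix.inv_eq_left_inv
    have hmul := cfc_mul (fun t : ℝ => t⁻¹) id x (hfin.continuousOn _) (hfin.continuousOn _)
    rw [cfc_id ℝ x hx'] at hmul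
    rw [← hmul]
    have : (spectrum ℝ x).EqOn (fun t : ℝ => t⁻¹ * id t) (fun _ => 1) := fun t ht =>
      inv_mul_cancel₀ (hpos t ht).ne'
    rw [cfc_congr this, cfc_const_one ℝ x]
  exact ⟨h1, h2, cfc_sqrt_mul_self hx.posSemidef, hrs, hsr, hrr⟩

end BendatShermanOneSided

section BendatShermanOneSided2

variable {n : ℕ}

/-- **Hansen–Pedersen's one-sided Bendat–Sherman theorem** (Hansen–Pedersen 1982, Theorem 2.4,
(ii) ⇒ (v); Hansen 2013 uses it in Lemma 4.1): if `f` satisfies Jensen's operator inequality at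
level `n` — in particular if `f` is operator convex on matrices with spectra in `I ∋ 0` and
`f(0) ≤ 0` — then `t ↦ t⁻¹ f(t)` is `n`-monotone on positive definite matrices with spectra in `I`:
with `a = (√y)⁻¹ √x` one has `a⋆ya = x`, `‖a‖ ≤ 1`, so `f(x) ≤ a⋆f(y)a = √x (√y)⁻¹ f(y) (√y)⁻¹ √x`,
and conjugating by `(√x)⁻¹` gives `x⁻¹f(x) ≤ y⁻¹f(y)`. [cite: Hansen2013, Lemma 4.1] -/
theorem cfc_inv_mul_monotone_of_jensen {f : ℝ → ℝ} {I : Set ℝ}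
    (hjensen : ∀ a z : Matrix (Fin n) (Fin n) ℂ, (1 - aᴴ * a).PosSemidef → (1 - a * aᴴ).PosSemidef →
      z.IsHermitian → spectrum ℝ z ⊆ I → (aᴴ * cfc f z * a - cfc f (aᴴ * z * a)).PosSemidef)
    {x y : Matrix (Fin n) (Fin n) ℂ} (hx : x.PosDef) (hy : y.PosDef) (hys : spectrum ℝ y ⊆ I)
    (hxy : (y - x).PosSemidef) :
    (cfc (fun t => t⁻¹ * f t) y - cfc (fun t => t⁻¹ * f t) x).PosSemidef := by
  obtain ⟨hsxh, hrxh, hssx, hrsx, hsrx, hrrx⟩ := cfc_sqrt_data hx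
  obtain ⟨hsyh, hryh, hssy, hrsy, hsry, hrry⟩ := cfc_sqrt_data hy
  set sx := cfc Real.sqrt x with hsx
  set rx := cfc (fun t => (Real.sqrt t)⁻¹) x with hrx
  set sy := cfc Real.sqrt y with hsy
  set ry := cfc (fun t => (Real.sqrt t)⁻¹) y with hry
  set a : Matrix (Fin n) (Fin n) ℂ := ry * sx with ha
  have haH : aᴴ = sx * ry := by rw [ha, conjTranspose_mul, hsxh.eq, hryh.eq]
  have hryy : ry * y * ry = 1 := by
    rw [← hssy, show ry * (sy * sy) * ry = (ry * sy) * (sy * ry) by simp only [Matrix.mul_assoc],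
      hrsy, hsry, Matrix.mul_one]
  have haya : aᴴ * y * a = x := by
    rw [haH, ha, show sx * ry * y * (ry * sx) = sx * (ry * y * ry) * sx by
      simp only [Matrix.mul_assoc], hryy, Matrix.mul_one, hssx]
  -- the two contraction properties
  have hinv : (x⁻¹ - y⁻¹).PosSemidef := by
    have h := inv_le_inv_of_posDef hx (by rw [Matrix.le_iff]; exact hxy)
    rw [Matrix.le_iff] at h; exact h
  have h1 : (1 - aᴴ * a).PosSemidef := by
    have e : 1 - aᴴ * a = sxᴴ * (x⁻¹ - y⁻¹) * sx := by
      rw [hsxh.eq, haH, ha, Matrix.mul_sub, Matrix.sub_mul, ← hrrx, ← hrry]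
      rw [show sx * (rx * rx) * sx = (sx * rx) * (rx * sx) by simp only [Matrix.mul_assoc], hsrx,
        hrsx, Matrix.mul_one]
      simp only [Matrix.mul_assoc]
    rw [e]; exact hinv.conjTranspose_mul_mul_same sx
  have h2 : (1 - a * aᴴ).PosSemidef := by
    have e : 1 - a * aᴴ = ryᴴ * (y - x) * ry := by
      rw [hryh.eq, ha, haH, Matrix.mul_sub, Matrix.sub_mul, hryy]
      rw [show ry * sx * (sx * ry) = ry * (sx * sx) * ry by simp only [Matrix.mul_assoc], hssx]
    rw [e]; exact hxy.conjTranspose_mul_mul_same ry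
  -- Jensen and conjugation by `(√x)⁻¹`
  have hJ := hjensen a y h1 h2 hy.1 hys
  rw [haya] at hJ
  have hconj := hJ.conjTranspose_mul_mul_same rx
  rw [hrxh.eq, Matrix.mul_sub, Matrix.sub_mul] at hconj
  -- identify the two terms
  have hfinx := Matrix.finite_real_spectrum (A := x)
  have hfiny := Matrix.finite_real_spectrum (A := y)
  have hposx : ∀ t ∈ spectrum ℝ x, 0 < t := fun t ht => spectrum_subset_Ioi_of_posDef hx ht
  have hposy : ∀ t ∈ spectrum ℝ y, 0 < t := fun t ht => spectrum_subset_Ioi_of_posDef hy ht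
  have hkey : ∀ {z : Matrix (Fin n) (Fin n) ℂ}, z.PosDef → (∀ t ∈ spectrum ℝ z, 0 < t) →
      cfc (fun t => (Real.sqrt t)⁻¹) z * cfc f z * cfc (fun t => (Real.sqrt t)⁻¹) z =
        cfc (fun t => t⁻¹ * f t) z := by
    intro z hz hpos
    have hfin := Matrix.finite_real_spectrum (A := z)
    rw [← cfc_mul (fun t => (Real.sqrt t)⁻¹) f z (hfin.continuousOn _) (hfin.continuousOn _),
      ← cfc_mul (fun t => (Real.sqrt t)⁻¹ * f t) (fun t => (Real.sqrt t)⁻¹) z (hfin.continuousOn _)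
        (hfin.continuousOn _)]
    refine cfc_congr fun t ht => ?_
    show (Real.sqrt t)⁻¹ * f t * (Real.sqrt t)⁻¹ = t⁻¹ * f t
    rw [mul_comm ((Real.sqrt t)⁻¹ * f t), ← mul_assoc, ← mul_inv, Real.mul_self_sqrt (hpos t ht).le]
  have ey : rx * (aᴴ * cfc f y * a) * rx = cfc (fun t => t⁻¹ * f t) y := by
    rw [haH, ha, show rx * (sx * ry * cfc f y * (ry * sx)) * rx = (rx * sx) * (ry * cfc f y * ry) * (sx * rx)
      by simp only [Matrix.mul_assoc], hrsx, hsrx, Matrix.one_mul, Matrix.mul_one]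
    exact hkey hy hposy
  have ex : rx * cfc f x * rx = cfc (fun t => t⁻¹ * f t) x := hkey hx hposx
  rw [ey, ex] at hconj
  exact hconj

end BendatShermanOneSided2

end Literature.Analysis.Complex
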